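import Mathlib
import HarnessLib
import HarnessLib.Audit
import Summits.CriticalPhenomena.Statement
import Literature.Probability.Percolation.SharpnessDCT

/-!
Route: PercHyperscalingGluing

# Route PercHyperscalingGluing — hyperscaling gluing pi_n^2 <= C avg in-box tau at p_c, plus
free-box shattering, gives theta(p_c)=0 with a two-line assembly

It suffices to show X = BoxGluing ∧ FreeBoxShattering (card box-hyperscaling-gluing, spine; items r2
and r3 of the card).
BoxGluing(K): there are C and K ≥ 1 with π_n² ≤ C·|Λ_n|⁻¹ Σ_{x∈Λ_n} P_{p_c}(0 ↔ x inside Λ_{Kn}) for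
all n ≥ 1, where
π_n = P_{p_c}(0 ↔ ∂Λ_n) (`siteToBoundary 3 n`) and Λ_m = `box 3 m` = [−m,m]³: two critical arms of
length n, rooted at 0 and at a
typical x ∈ Λ_n, lie in ONE open cluster of the box Λ_{Kn} with conditional probability ≥ 1/C — the
"≤" half of the hyperscaling
relation 2β/ν = d−2+η (Grimmett1999 (9.37); Aizenman1997 App.: proliferation exponent # = 0),
exponent-free, averaged, box-restricted;
an identity numerically in d = 3 (0.954 = 0.954) and false above six dimensions. FreeBoxShattering:
F_r := |Λ_r|⁻¹ Σ_{x∈Λ_r}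
P_{p_c}(0 ↔ x inside Λ_r) → 0 (Hutchcroft2022 p.5, "folklore", unproved in print; implied by the
conjunct). Then
θ(p_c)² ≤ π_n² ≤ C K³ F_{Kn} → 0: the Assembly is PROVED sorry-free in the planner's Sketch.lean
(assembly_holds).
Lean: `(∃ C : ℝ, ∃ K : ℕ, 0 < C ∧ 1 ≤ K ∧ ∀ n : ℕ, 1 ≤ n →
(Literature.Probability.Percolation.bondPercolation (Literature.Probability.LatticeModels.zdGraph 3)
(Literature.Probability.Percolation.criticalProbI 3)).real
(Literature.Probability.Percolation.siteToBoundary 3 n) ^ 2 ≤ C *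
((Literature.Probability.LatticeModels.box 3 n).card : ℝ)⁻¹ * ∑ x ∈
Literature.Probability.LatticeModels.box 3 n, (Literature.Probability.Percolation.bondPercolation
(Literature.Probability.LatticeModels.zdGraph 3) (Literature.Probability.Percolation.criticalProbI
3)).real (Literature.Probability.Percolation.openConnIn ↑(Literature.Probability.LatticeModels.box 3
(K * n)) 0 x)) ∧ (Filter.Tendsto (fun r : ℕ => ((Literature.Probability.LatticeModels.box 3 r).card
: ℝ)⁻¹ * ∑ x ∈ Literature.Probability.LatticeModels.box 3 r,
(Literature.Probability.Percolation.bondPercolation (Literature.Probability.LatticeModels.zdGraph 3)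
(Literature.Probability.Percolation.criticalProbI 3)).real
(Literature.Probability.Percolation.openConnIn ↑(Literature.Probability.LatticeModels.box 3 r) 0 x))
Filter.atTop (nhds 0))`

## Assembly
Pure bookkeeping, PROVED in the planner's Sketch.lean (`assembly_holds : Assembly`, 60 lines, lean
check rc 0, axioms propext / Classical.choice / Quot.sound): let θ := theta (zdGraph 3) 0
(criticalProbI 3) ≥ 0; for n ≥ 1, θ ≤ π_n
(Literature.Probability.Percolation.DCT16.theta_le_real_siteToBoundary), so θ² ≤ π_n² ≤
C|Λ_n|⁻¹Σ_{x∈Λ_n} τ^{Λ_{Kn}}(0,x) (BoxGluing) ≤ C|Λ_n|⁻¹Σ_{x∈Λ_{Kn}} τ^{Λ_{Kn}}(0,x) (box_mono,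
terms ≥ 0) = C(|Λ_{Kn}|/|Λ_n|)·F_{Kn} ≤ C K³ F_{Kn} (card_box: (2Kn+1)³ ≤ K³(2n+1)³); F_{Kn} → 0
(FreeBoxShattering composed with n ↦ Kn → ∞); le_of_tendsto_of_tendsto gives θ² ≤ 0, hence θ = 0,
which is PercolationContinuityZ3 by Iff.rfl.

Rationale: WHY THIS LINE. Mechanism: the BK inequality gives τ(0,x) ≤ π_{|x|/3}² (in exponents d−2+η ≥ 2/ρ,
Hutchcroft2021 p.10; tree: tau_farPoint_le_oneArmProb_sq); the REVERSE inequality "two nearby long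
arms belong to the same cluster" is Coniglio's/Aizenman's heuristic basis of hyperscaling
(Aizenman1997 App. A: # = 0 ⟺ d = (2β+γ)/ν; Grimmett1999 §9.2 (9.37): "the proportion of x with |x|
≤ k joined to the origin ≈ P(x in a cluster of radius ≥ k)") and Kesten's 2D quasi-multiplicativity
(KestenScalingCMP1987), never stated as an exponent-free inequality in d = 3; we state it
box-restricted so that it pairs with the free-box shattering statement and closes θ(p_c) = 0 in two
lines with NO block renormalisation, sprinkling, or rate (assembly_holds, this folder). Imported
area: finite-size scaling / spanning-cluster statistics of statistical physics (Coniglio 1985,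
Aizenman1997, BorgsChayesKestenSpencer1999) turned into two inequalities between percolation
probabilities at one scale; the engine crux ArmsInFewClusters is BCKS's tightness hypothesis recast
(arm-biased) so that Cauchy–Schwarz over the clusters of armed sites yields BoxGluing (glue
FewClustersGlue, elementary, in NOTES). What it does that prior routes do not: PercTwoPointDecay
wants an UPPER bound on the ball-averaged τ (blocked: no infrared bound, η<0); PercFiniteBoxLRO
wants Cerf's X_D (vacuous at the real p_c) plus the renormalisation R (SprinklingRenormalisation
barrier) — here the d<6 crux has content AT the real critical point, the support item CerfShortcut
records that X_D + FreeBoxShattering already give the conjunct (R superfluous), and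
PercAnnulusCrossing asks crossings to FAIL (RSW upper bound) whereas BoxGluing tolerates crossing
probability → 1. Sibling card nonproliferation-is-enough counts crossing clusters against a density
(ergodic) argument; this line instead produces a real-world inequality (BoxGluing) and uses
tightness only as an engine. Negatives index (1 SAW statement) untouched.

RANKED CRUXES. #2 BoxGluing (crux) — BoxGluing(K) (card r2): ∃ C > 0, K ≥ 1 such that ∀ n ≥ 1,
P_{p_c}(0 ↔ ∂Λ_n)² ≤ C · |Λ_n|⁻¹ · Σ_{x ∈ Λ_n} P_{p_c}(0 ↔ x inside Λ_{Kn}) for bond percolation on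
ℤ³ at p_c = criticalProbI 3 (Λ_m = box 3 m; "inside" = openConnIn ↑(box 3 (K n))). Exponent reading:
2β/ν ≤ d−2+η (the open half; "≥" is BK). In a jump world it says θ*² ≤ C·(averaged linear-scale
in-box LRO), i.e. jump ⟹ monolithic. [difficulty: open-problem] (why it might fail: Open half of a
hyperscaling relation (none proved for 3<=d<=6, Hutchcroft2021 p.10); its analogue is FALSE for
d>=11 (pi_n ~ n^-2, tau ~ |x|^(2-d): KozmaNachmias2011, FitznerVanDerHofstad2017); false in a
shattered jump world; the box restriction costs an unproved factor c_K.) [GrimmettPercolation1999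
§9.2 (9.37) p.243, Aizenman1997 App. A (arXiv:cond-mat/9609240 p.11) and Thm 4, Hutchcroft2021 §2
p.10 (arXiv:2008.11197 p.10: hyperscaling open for 2<d<=6 and the BCKS inequalities d rho >= delta+1
and d-2+eta >= 2/rho), BorgsChayesKestenSpencer1999, KestenScalingCMP1987, KozmaNachmias2011 Thm 1
(one-arm exponent 2 in high d), FitznerVanDerHofstad2017 Thm 1.1 (eta = 0 for d >= 11),
arXiv:1302.0421 (beta/nu = 0.477 and d_f = 2.523 in d = 3)]
#3 FreeBoxShattering (crux) — Free-box shattering at p_c (card r3; shared verbatim with cards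
nonproliferation-is-enough r3, critical-cluster-threshold-one D4, hollow-cells-inbox-shattering F1):
F_r := |Λ_r|⁻¹ Σ_{x∈Λ_r} P_{p_c}(0 ↔ x inside Λ_r) → 0 as r → ∞ — the in-box cluster of the CENTRE
of the free box [−r,r]³ has expected size o(r³); equivalently (re-rooting within factor 64, +
Hutchcroft2021 Thm 2.2 universal tightness) the largest free-boundary critical cluster has density →
0 in probability (cards free-box-folklore-knife-edge (1), free-box-shattering-is-a-branch (2)).
Printed as "a well-known (and not too difficult) folklore theorem … in every dimension d ≥ 2"
(Hutchcroft2022 p.5) without proof or reference; TRUE if the conjunct holds (P(0 ↔ x inside Λ_r) ≤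
π_{|x|∞} → θ(p_c)); the CORNER-rooted version is a corollary of BarskyGrimmettNewman1991. A grounder
should first ask whether a proof exists in print (candidate owners: Hutchcroft; Kozma–Nachmias 2011
§1; BCKS 2001). [difficulty: L] (why it might fail: Printed as folklore WITHOUT proof
(Hutchcroft2022 p.5); 2 refuters + 3 cards found none: BGN gives only a boundary layer, lowest-point
BK needs x_s+x_b>3/2 (numerics 1.45), Russo/AN bounds saturate at gamma=1; unconditionally it must
kill the monolithic jump branch (linear in-box LRO at p_c).) [Hutchcroft2022 p.5 (arXiv:2202.07634
sentence read verbatim), BarskyGrimmettNewman1991 (half-space/orthant: corner version),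
Hutchcroft2021 Thm 2.2 (arXiv:2008.11197 p.11 universal tightness of |K_max|), Cerf2015 p.4
(arXiv:1306.3105: linear-scale in-box LRO is the missing ingredient), GrimmettPercolation1999 Thm
(7.35) and §7.3 p.162]
#4 ArmsInFewClusters (crux) — Arm-biased tightness of large clusters (card engine E2 / r5, made
exponent-free and sufficient): ∃ N0, K ≥ 2, c > 0 such that ∀ n ≥ 1, Σ_{x∈Λ_n} P_{p_c}(A_x ∩ Few) ≥
c · Σ_{x∈Λ_n} P_{p_c}(A_x), where A_x = {x ↔ x+∂Λ_n inside x+Λ_n} = DCT16.armEvent x n (so Σ_x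
P(A_x) = |Λ_n| π_n) and Few = {ω : every family F ⊆ Λ_n of n-armed sites that are pairwise NOT
joined inside Λ_{Kn} has |F| ≤ N0} = "the n-armed sites of Λ_n meet at most N0 open clusters of
Λ_{Kn}". Words: a fixed fraction of the expected number of n-armed sites is carried by
configurations with ≤ N0 spanning-type clusters — Coniglio's "O(1) large clusters per scale",
Aizenman's proliferation exponent # = 0 in tight form, BCKS's hypothesis in cluster-number form.
Implies BoxGluing (support FewClustersGlue). [difficulty: XL] (why it might fail: It is
Coniglio/BCKS tightness: unproved in d=3, FALSE for d>6 (~n^(d-6) spanning clusters, Aizenman1997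
Thm 4); the arm bias asks uniform integrability of N, not mere tightness; no tool counts distinct
clusters at aspect ratio K (Cerf2015: n^42; VandenbergVanengelenburg2022 Prop 2).) [Aizenman1997 Thm
3 (d=2: P(n spanning clusters) <= e^(-a n^2)) and Thm 4 (d>6 proliferation) and App. A (moments k=1
and k=2 of armed cluster volumes), BorgsChayesKestenSpencer1999 (hypothesis = tightness of
easy-direction crossing clusters as summarised by Hutchcroft2021 p.10), Cerf2015 Thm 1.2,
VandenbergVanengelenburg2022 Prop 2, Literature.Barriers.CriticalPhenomena.SpanningClustersAboveSix]
#9 FewClustersGlue (support) — ArmsInFewClusters → BoxGluing (both Props inlined). Proof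
(elementary, planner NOTES §glue): S := #{x ∈ Λ_n armed}, T := #{(x,y) ∈ Λ_n² : both armed, x ↔ y
inside Λ_{Kn}} = Σ_classes W_c², N := #classes of armed sites under "joined inside Λ_{Kn}";
Cauchy–Schwarz S² ≤ N·T, so T ≥ S²/N0 on Few; E[T·1_Few] ≥ E[S²1_Few]/N0 ≥ (E[S 1_Few])²/N0 ≥ c²(E
S)²/N0 = c²|Λ_n|²π_n²/N0 (E[S 1_Few] = Σ_x P(A_x ∩ Few); P(A_x) = π_n by
DCT16.preimage_shift_siteToBoundary + shift-invariance of bondPercolation); E T ≤ Σ_{x,y∈Λ_n} P(x ↔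
y inside Λ_{Kn}) ≤ |Λ_n| Σ_{z∈Λ_{2n}} P(0 ↔ z inside Λ_{(K+1)n}) (shift by −x, Λ_{Kn}−x ⊆
Λ_{(K+1)n}); hence π_{2n}² ≤ π_n² ≤ (8N0/c²)|Λ_{2n}|⁻¹Σ_{z∈Λ_{2n}} τ^{Λ_{2Kn}}(0,z)
(real_siteToBoundary_antitone, box_mono, |Λ_{2n}| ≤ 8|Λ_n|); odd n by the same monotonicity with one
more factor 8; n small absorbed in C. [difficulty: M] [Aizenman1997 App. A,
BorgsChayesKestenSpencer1999,
Literature.Probability.Percolation.DCT16.preimage_shift_siteToBoundary,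
Literature.Probability.Percolation.DCT16.real_siteToBoundary_antitone]
#9 CerfShortcut (support) — Cerf's X_D (= crux LinearScaleLROOfTheta of route PercFiniteBoxLRO,
stmt-CriticalPhenomena-0855, Prop copied verbatim) → FreeBoxShattering → PercolationContinuityZ3: if
θ(p_c) > 0, X_D at p = criticalProbI 3 gives ρ > 0, K with ρ ≤ P_{p_c}(0 ↔ y inside Λ_{Kn}) for all
y ∈ Λ_n, n ≥ 1; if K = 0 this is absurd at y ≠ 0 (openConnIn {0} 0 y = ∅); if K ≥ 1 then
|Λ_{Kn}|·F_{Kn} ≥ Σ_{y∈Λ_n} P(0 ↔ y inside Λ_{Kn}) ≥ ρ|Λ_n| ≥ ρ|Λ_{Kn}|/K³·(1/8), so F_{Kn} ≥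
ρ/(8K³) for all n, contradicting F → 0 along r = Kn. Records that the renormalisation crux R
(RenormaliseFromLinearLRO, stmt-CriticalPhenomena-0857) of PercFiniteBoxLRO is superfluous once the
free box shatters; its tenure planner may attach this item there. [difficulty: provable-now]
[Cerf2015 Thm 1.3 and p.4 (arXiv:1306.3105), Hutchcroft2022 p.5,
Literature.Probability.Percolation.theta_eq_zero_of_lt_criticalProb_holds]

TWO-LAYER PLAN. Foreseen glued splits (nothing filed now beyond the support glue): BoxGluing ⇐
ArmsInFewClusters → BoxGluing (glue = FewClustersGlue, already a support item); BoxGluing ⇐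
FullSpaceGluing (π_n² ≤ C avg_{Λ_n} τ) → BoxRestriction (avg_{Λ_n} τ ≤ C_K avg_{Λ_n} τ^{Λ_{Kn}}) →
BoxGluing; BoxGluing ⇐ ContactSurgery (AKN/GGR: P(two armed clusters within distance n are distinct
but adjacent across a closed edge) ≤ C E[N_piv; 0 ↔ x in Λ_{Kn}]) → PivotalSparsity → BoxGluing
(card engine E1, typed only once E1's FKG contact step is made precise); FreeBoxShattering ⇐
NoFreeGiant (|K_max(Λ_r)|/|Λ_r| → 0 in probability; equivalent up to Hutchcroft2021 Thm 2.2) or ⇐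
DensePieceUniqueness + BGN nested-floor lemma (cards dense-piece-uniqueness-hub,
free-box-shattering-is-a-branch (4)).

KILL CRITERIA. ¬BoxGluing for every K (e.g. the Monte-Carlo ratio of § Cheapest falsifier growing
like a power of n, followed by a proof) closes the route `refuted:BoxGluing` — the line IS
BoxGluing; keep FreeBoxShattering alive for the sibling cards. ¬FreeBoxShattering would refute the
CONJUNCT itself (continuity ⟹ F_r → 0): summit-level event, not a route repair. FreeBoxShattering
shown to need Cerf's R (i.e. as hard as excluding the monolithic branch with no new idea) ⟹ pivot:
restate the assembly as BoxGluing → R_avg → conjunct, where R_avg = "averaged linear-scale in-box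
LRO at p ⟹ percolation at some p' < p" (shared territory with PercFiniteBoxLRO r3), and re-rank
FreeBoxShattering to support. ¬ArmsInFewClusters (proliferation of armed clusters at aspect ratio K
in d = 3) drops engine E2 only; BoxGluing then rests on contact surgery (E1) or is itself in doubt —
re-run the falsifier. Proved elsewhere: any proof of the conjunct (PercTwoPointDecay's
CritBallAverageDecay, PercHalfSpace, …) moots the assembly; BoxGluing keeps independent value as the
first hyperscaling inequality of its kind in d = 3.

NOT DECOMPOSED YET. The AKN contact-surgery engine E1 of the card (pivotal sparsity E[N_piv | 0 ↔ x
in Λ_{Kn}] ≤ C n^b plus an FKG "bring two large clusters into contact" step) — no clean implication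
to BoxGluing is typable until the contact step is stated; the card's r4 is therefore NOT filed. The
BK converse τ^Λ(0,x) ≤ π_{|x|/3}² (in tree for far points: tau_farPoint_le_oneArmProb_sq) — not
needed by the assembly. The box-restriction lemma τ^{Λ_{Kn}} ≥ c_K τ on Λ_n and the full-space
gluing (layer-2 children of BoxGluing). Rates (F_r ≤ C r^{−a}, a ≈ 0.95; π_n ≍ n^{−0.477}) —
deliberately absent: every statement is exponent-free. The ergodic density count of card
nonproliferation-is-enough (a different assembly for a tightness crux). Constants C, K, N0, c are
existential throughout.

CHEAPEST FALSIFIER. Monte-Carlo at p_c(bond, ℤ³) = 0.2488126 (Newman–Ziff / union-find on Λ_{Kn}, n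
= 8…96, K = 2, 3; ~1 CPU-day): the BoxGluing ratio R_n(K) := π_n²·|Λ_n| / Σ_{x∈Λ_n} τ^{Λ_{Kn}}(0,x).
Prediction: R_n(K) flat in n (bounded, K-dependent); growth like n^a with a clearly > 0 kills
BoxGluing as stated (only the useless full-space form would survive). The same run measures F_r
(prediction ≍ r^{−0.95}, decreasing) and the law of N = #clusters of Λ_{Kn} containing n-armed sites
of Λ_n, arm-weighted (prediction: tight, fast tails — ArmsInFewClusters). NOT run in this one-shot
planner seat (kit compute socket absent on the hub 2026-08-15; recommended as the refuter's first
kit job, spec above). Lookup falsifier: BCKS 1999 §§1–2 (paywalled, acq-02015) — check whether their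
tightness ⟹ hyperscaling argument is already exponent-free at fixed scale (would downgrade
FewClustersGlue/ArmsInFewClusters to `known`, not kill the line).

NUMBERS. p_c(bond, ℤ³) = 0.2488126(5); d_f = 2.5230(2) so β/ν = 3 − d_f = 0.477, and 2 − η = 2d_f −
3 = 2.046 (η = −0.046): both sides of 2β/ν = d − 2 + η equal 0.954 (arXiv:1302.0421 and refs there)
— BoxGluing is an equality of exponents in d = 3. Rejected variants (planner check): wall-rooted RHS
with bulk LHS needs x_s + x_b ≤ 2x_b, false (x_s = 0.975 > x_b, Deng–Blöte 2005 via card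
free-box-folklore-knife-edge); wall-rooted LHS reduces the assembly to BGN. High d (d ≥ 11): π_n ≍
n⁻² (KozmaNachmias2011 + FitznerVanDerHofstad2017), τ ≍ |x|^{2−d}, so π_n²/avg_{Λ_n}τ ≍ n^{d−6} → ∞:
BoxGluing false, ≍ L^{d−6} spanning clusters (Aizenman1997 Thm 4). d = 2: P(n spanning clusters) ≤
e^{−α n²} (Aizenman1997 Thm 3), hyperscaling proved given exponents (KestenScalingCMP1987). Cerf2015
Thm 1.2: two distinct clusters Λ_n → ∂Λ_{n^α} vanish only for α > 43.6 (d = 3, site). Items at open: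
6 (3 cruxes, 2 support, 1 assembly).

DEFINITION REQUESTS. None: box, openConnIn, siteToBoundary, criticalProbI, DCT16.armEvent
(Literature.Probability.Percolation.SharpnessDCT, listed in imports) all exist; "number of clusters
≤ N0" is phrased through pairwise-disjoint families of armed sites (no quotient types). Cite fact
wanted later (not blocking): BorgsChayesKestenSpencer1999 main theorem as a Literature named fact
once acq-02015 (paywalled Wiley) is fulfilled.

Novelty: Searches (2026-08-15): `lit search --hybrid --source local "number of spanning clusters hyperscaling
critical percolation three dimensions"` (10 docs: GrimmettPercolation1999 §9.2 pp.243–244 read,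
Aizenman1997 read, HeydenreichVanDerHofstad2017, Slade2006 …); `lit galaxy search "implies
hyperscaling" --star all` (8 rows: BCKS itself not held → `lit read doi:10.1002/(sici)1098-2418…` rc
3, acq-02015; Dewan–Muirhead arXiv:2102.12123 one-arm bounds for dependent models; van den
Berg–Conijn arXiv:1310.2019, 2D); `lit search --source zbmath "uniform boundedness of critical
crossing probabilities implies hyperscaling"` (1, summary read); `lit read arXiv:2202.07634` p.5
(folklore sentence verbatim), `arXiv:2008.11197` p.10 (status: hyperscaling "completely open" for
2<d≤6 even given exponents; BCKS = tightness of easy-direction crossing clusters ⟹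
scaling+hyperscaling given ρ; inequalities dρ ≥ δ+1, d−2+η ≥ 2/ρ), `arXiv:cond-mat/9609240` App. A
(proliferation exponent #, moments k = 1, 2 — exactly the S, T of FewClustersGlue); `lit vsearch
"square of the one-arm probability bounded by averaged two-point function …"` (10 books, nothing
specific); `lit frontier CriticalPhenomena --since 2020` (30 rows; none on d = 3
hyperscaling/gluing), `lit bridges CriticalPhenomena --cross any` (none relevant); the 9 route files
of the sub-problem; cards box-hyperscaling-gluing (+ its novelty audit), nonproliferation-is-enough,
free-box-folklore-knife-edge, free-box-shattering-is-a-branch, shatteri  [refs: 10.1002/(sici, 2102.12123, 1310.2019, 2202.07634, 2008.11197, cond-mat/9609240, doi:10.1002/, GrimmettPercolation1999, Aizenman1997, HeydenreichVanDerHofstad2017, BorgsChayesKestenSpencer1999, KestenScalingCMP1987, Hutchcroft2022]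

Barriers (technique_class: box-hyperscaling-gluing, spanning-cluster-tightness): - technique_class: box-hyperscaling-gluing, spanning-cluster-tightness
- Literature.Barriers.CriticalPhenomena.SpanningClustersAboveSix: APPLIES by design and is the
calibration — BoxGluing and ArmsInFewClusters are false for d ≥ 11 (π_n²/avg τ ≍ n^(d−6); ≍ L^(d−6)
spanning clusters, Aizenman1997 Thm 4 under η = 0), so every proof of either must use a d < 6 input;
the route does not evade the barrier, it names the d < 6 statement to be proved (contact dimension
2d_f − d = 2.05 > 0 for E1; tightness for E2).
- Literature.Barriers.CriticalPhenomena.TransverseCrossingsNeedNotMeet: engaged by any PROOF of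
BoxGluing (gluing two arms is the missing 3D substitute for planar crossing-intersection/RSW); weak
evasion only: the gluing is demanded on AVERAGE over x in a volume, never for two prescribed
crossings; the assembly itself glues nothing (it is proved).
- Literature.Barriers.CriticalPhenomena.SprinklingRenormalisation: evaded — no block construction,
no p ↦ p + η; everything happens at the fixed parameter criticalProbI 3 and the assembly is already
sorry-free.
- Literature.Barriers.CriticalPhenomena.GaussianDominationRoute: not engaged — no infrared/upper
bound on τ is sought (τ is bounded BELOW by π² inside a box); both sides of BoxGluing carry the same
anomalous dimension, so η < 0 (EtaNegativePredictionZ3) is harmless; it does bite the rejected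
wall-rooted variants (x_s + x_b numerology, see Numbers).
- Literature.Barriers.CriticalPhenomena.RandomClusterFirstOrder: the pair (

sub-problem: PercolationContinuityZ3 · status: draft · opened planner-plancard-CriticalPhenomena-Percolatio-6e0b3456-0 2026-08-15T11:34:44Z · rev 2 · ledger route-CriticalPhenomena-PercHyperscalingGluing
GENERATED by the gate from the ledger (D-0016/17). Provers cite these decls: `theorem foo : Summit.CriticalPhenomena.PercolationContinuityZ3.Theses.PercHyperscalingGluing.<Decl> := …` in Summits/CriticalPhenomena/PercolationContinuityZ3/Theorems/<Name>.lean.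
-/

namespace Summit.CriticalPhenomena.PercolationContinuityZ3.Theses.PercHyperscalingGluing

open scoped BigOperators Topology Manifold Classical MeasureTheory ProbabilityTheory Matrix InnerProductSpace ComplexConjugate ContinuousMap
open Filter Set Function TopologicalSpace MeasureTheory

attribute [summit_statement] _root_.PercolationContinuityZ3

/-- item stmt-CriticalPhenomena-4643 · crux · rank 2 · open · by planner
why it might fail: Open '<=' half of hyperscaling (2/rho >= d-2+eta; BK/BCKS give only the reverse), unproved for 3<=d<=6 even granting exponents (Hutchcroft2021 p.10); FALSE for d>=11: pi_n~n^-2, tau~|x|^(2-d) give pi_n^2/avg tau ~ n^(d-6) -> oo (KozmaNachmias2011, FitznerVanDerHofstad2017); box factor K unproved.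
sources: Hutchcroft2021 §2 p.10 (arXiv:2008.11197: hyperscaling open for 2<d<=6; BCKS inequalities d rho >= delta+1, d-2+eta >= 2/rho), BorgsChayesKestenSpencer1999, Aizenman1997 App. A and Thm 4 (arXiv:cond-mat/9609240), GrimmettPercolation1999 §9.2 (9.37) p.243, KozmaNachmias2011 Thm 1, FitznerVanDerHofstad2017 Thm 1.1
[crux] BoxGluing(K) (card r2): ∃ C > 0, K ≥ 1 such that ∀ n ≥ 1, P_{p_c}(0 ↔ ∂Λ_n)² ≤ C · |Λ_n|⁻¹ ·
Σ_{x ∈ Λ_n} P_{p_c}(0 ↔ x inside Λ_{Kn}) for bond percolation on ℤ³ at p_c = criticalProbI 3 (Λ_m =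
box 3 m; "inside" = openConnIn ↑(box 3 (K n))). Exponent reading: 2β/ν ≤ d−2+η (the open half; "≥"
is BK). In a jump world it says θ*² ≤ C·(averaged linear-scale in-box LRO), i.e. jump ⟹ monolithic.
[difficulty: open-problem] -/
@[route_item "route-CriticalPhenomena-PercHyperscalingGluing"]
def BoxGluing : Prop :=
  ∃ C : ℝ, ∃ K : ℕ, 0 < C ∧ 1 ≤ K ∧ ∀ n : ℕ, 1 ≤ n → (Literature.Probability.Percolation.bondPercolation (Literature.Probability.LatticeModels.zdGraph 3) (Literature.Probability.Percolation.criticalProbI 3)).real (Literature.Probability.Percolation.siteToBoundary 3 n) ^ 2 ≤ C * ((Literature.Probability.LatticeModels.box 3 n).card : ℝ)⁻¹ * ∑ x ∈ Literature.Probability.LatticeModels.box 3 n, (Literature.Probability.Percolation.bondPercolation (Literature.Probability.LatticeModels.zdGraph 3) (Literature.Probability.Percolation.criticalProbI 3)).real (Literature.Probability.Percolation.openConnIn ↑(Literature.Probability.LatticeModels.box 3 (K * n)) 0 x)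

/-- item stmt-CriticalPhenomena-4644 · crux · rank 3 · closed · proved by Summit.CriticalPhenomena.PercolationContinuityZ3.Theorems.HyperscalingGluingFreeBoxShattering.freeBoxShattering_proof @ 11dc27a29963 (prover) · by planner
why it might fail: Asserted as 'folklore' with NO proof in print (Hutchcroft2022 p.5); grounder, 2 refuters, 3 cards found none; BGN1991 shatters only boundary-rooted clusters; unconditionally it must exclude the monolithic jump (theta(p_c)>0 with linear-scale in-box LRO, Cerf2015 p.4): a branch of theta(p_c)=0.
sources: Hutchcroft2022 p.5 (arXiv:2202.07634, folklore sentence), Cerf2015 Thm 1.3 and p.4 (arXiv:1306.3105), BarskyGrimmettNewman1991, Hutchcroft2021 Thm 2.2 (arXiv:2008.11197 p.11, universal tightness of |K_max|), GrimmettPercolation1999 Thm (7.35), §7.3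
[crux] Free-box shattering at p_c (card r3; shared verbatim with cards nonproliferation-is-enough
r3, critical-cluster-threshold-one D4, hollow-cells-inbox-shattering F1): F_r := |Λ_r|⁻¹ Σ_{x∈Λ_r}
P_{p_c}(0 ↔ x inside Λ_r) → 0 as r → ∞ — the in-box cluster of the CENTRE of the free box [−r,r]³
has expected size o(r³); equivalently (re-rooting within factor 64, + Hutchcroft2021 Thm 2.2
universal tightness) the largest free-boundary critical cluster has density → 0 in probability
(cards free-box-folklore-knife-edge (1), free-box-shattering-is-a-branch (2)). Printed as "a
well-known (and not too difficult) folklore theorem … in every dimension d ≥ 2" (Hutchcroft2022 p.5)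
without proof or reference; TRUE if the conjunct holds (P(0 ↔ x inside Λ_r) ≤ π_{|x|∞} → θ(p_c));
the CORNER-rooted version is a corollary of BarskyGrimmettNewman1991. A grounder should first ask
whether a proof exists in print (candidate owners: Hutchcroft; Kozma–Nachmias 2011 §1; BCKS 2001).
[difficulty: L] -/
@[route_item "route-CriticalPhenomena-PercHyperscalingGluing"]
def FreeBoxShattering : Prop :=
  Filter.Tendsto (fun r : ℕ => ((Literature.Probability.LatticeModels.box 3 r).card : ℝ)⁻¹ * ∑ x ∈ Literature.Probability.LatticeModels.box 3 r, (Literature.Probability.Percolation.bondPercolation (Literature.Probability.LatticeModels.zdGraph 3) (Literature.Probability.Percolation.criticalProbI 3)).real (Literature.Probability.Percolation.openConnIn ↑(Literature.Probability.LatticeModels.box 3 r) 0 x)) Filter.atTop (nhds 0)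

/-- item stmt-CriticalPhenomena-4645 · crux · rank 4 · open · by planner
why it might fail: Coniglio/BCKS tightness of spanning-type clusters: unproved for 3<=d<=6 (Hutchcroft2021 p.10), FALSE for d>6 (~L^(d-6) spanning clusters, Aizenman1997 Thm 4); the arm-weighted form asks uniform integrability, beyond tightness; d=3 tools separate two clusters only at scale n^43 (Cerf2015 Thm 1.2).
sources: Aizenman1997 Thm 3 (d=2), Thm 4 (d>6 proliferation), App. A (arXiv:cond-mat/9609240), BorgsChayesKestenSpencer1999, Hutchcroft2021 p.10 (arXiv:2008.11197), Cerf2015 Thm 1.2 (arXiv:1306.3105), VandenbergVanengelenburg2022 Prop 2, Literature.Barriers.CriticalPhenomena.SpanningClustersAboveSix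
[crux] Arm-biased tightness of large clusters (card engine E2 / r5, made exponent-free and
sufficient): ∃ N0, K ≥ 2, c > 0 such that ∀ n ≥ 1, Σ_{x∈Λ_n} P_{p_c}(A_x ∩ Few) ≥ c · Σ_{x∈Λ_n}
P_{p_c}(A_x), where A_x = {x ↔ x+∂Λ_n inside x+Λ_n} = DCT16.armEvent x n (so Σ_x P(A_x) = |Λ_n| π_n)
and Few = {ω : every family F ⊆ Λ_n of n-armed sites that are pairwise NOT joined inside Λ_{Kn} has
|F| ≤ N0} = "the n-armed sites of Λ_n meet at most N0 open clusters of Λ_{Kn}". Words: a fixed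
fraction of the expected number of n-armed sites is carried by configurations with ≤ N0
spanning-type clusters — Coniglio's "O(1) large clusters per scale", Aizenman's proliferation
exponent # = 0 in tight form, BCKS's hypothesis in cluster-number form. Implies BoxGluing (support
FewClustersGlue). [difficulty: XL] -/
@[route_item "route-CriticalPhenomena-PercHyperscalingGluing"]
def ArmsInFewClusters : Prop :=
  ∃ N0 K : ℕ, ∃ c : ℝ, 0 < c ∧ 2 ≤ K ∧ ∀ n : ℕ, 1 ≤ n → c * ∑ x ∈ Literature.Probability.LatticeModels.box 3 n, (Literature.Probability.Percolation.bondPercolation (Literature.Probability.LatticeModels.zdGraph 3) (Literature.Probability.Percolation.criticalProbI 3)).real (Literature.Probability.Percolation.DCT16.armEvent x n) ≤ ∑ x ∈ Literature.Probability.LatticeModels.box 3 n, (Literature.Probability.Percolation.bondPercolation (Literature.Probability.LatticeModels.zdGraph 3) (Literature.Probability.Percolation.criticalProbI 3)).real (Literature.Probability.Percolation.DCT16.armEvent x n ∩ {ω | ∀ F : Finset (Literature.Probability.LatticeModels.Site 3), F ⊆ Literature.Probability.LatticeModels.box 3 n → (∀ y ∈ F, ω ∈ Literature.Probability.Percolation.DCT16.armEvent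 y n) → (↑F : Set (Literature.Probability.LatticeModels.Site 3)).Pairwise (fun y z => ω ∉ Literature.Probability.Percolation.openConnIn ↑(Literature.Probability.LatticeModels.box 3 (K * n)) y z) → F.card ≤ N0})

/-- item stmt-CriticalPhenomena-10348 · support · rank 9 · closed · proved by Summit.CriticalPhenomena.PercolationContinuityZ3.Theorems.percHyperscalingGluing_thetaLeOneArm_proof @ 1a81be5e7dce (prover) · by planner
[support] Known fact (Grimmett1999 §1.4, `θ(p) ≤ P_p(0 ↔ ∂B(n))`): for bond percolation on ℤ^d,
every p ∈ [0,1] and every n, θ(p) = P_p(|C(0)| = ∞) ≤ P_p(0 ↔ ∂Λ_n inside Λ_n) = `(bondPercolation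
(zdGraph d) p).real (siteToBoundary d n)` — an infinite open cluster of 0 leaves Λ_n and, a.s. (ω ⊆
E(ℤ^d)), its first exit passes through ∂Λ_n. PROVED in tree as
`Literature.Probability.Percolation.DCT16.theta_le_real_siteToBoundary`
(Literature/Probability/Percolation/SharpnessDCTProofs.lean:1527), which is NOT in this route file's
import closure (the file imports SharpnessDCT only, deliberately: no extra cone); a Theorems file
discharges this item in one line, `theorem thetaLeOneArm : PercHyperscalingGluing.ThetaLeOneArm :=
fun _d p n => Literature.Probability.Percolation.DCT16.theta_le_real_siteToBoundary p n` (checked: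
planner folder DischargeTest.lean, lean check rc 0, axioms propext/Classical.choice/Quot.sound). It
is the only non-crux hypothesis of the deciding theorem `closes : BoxGluing → FreeBoxShattering →
ThetaLeOneArm → PercolationContinuityZ3` (θ² ≤ π_n² ≤ C·K³·F_{Kn} → 0). [deps: none] [difficulty:
provable-now] [sources: GrimmettPercolation1999 §1.4; Literature.Probability. -/
@[route_item "route-CriticalPhenomena-PercHyperscalingGluing"]
def ThetaLeOneArm : Prop :=
  ∀ (d : ℕ) (p : unitInterval) (n : ℕ), Literature.Probability.Percolation.theta (Literature.Probability.LatticeModels.zdGraph d) 0 p ≤ (Literature.Probability.Percolation.bondPercolation (Literature.Probability.LatticeModels.zdGraph d) p).real (Literature.Probability.Percolation.siteToBoundary d n)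

/-- item stmt-CriticalPhenomena-4646 · support · rank 9 · closed · proved by Summit.CriticalPhenomena.PercolationContinuityZ3.Theorems.fewClustersGlue_proof @ 3461f34e8d74 (prover) · by planner
sources: Aizenman1997 App. A, BorgsChayesKestenSpencer1999, Literature.Probability.Percolation.DCT16.preimage_shift_siteToBoundary, Literature.Probability.Percolation.DCT16.real_siteToBoundary_antitone
[support] ArmsInFewClusters → BoxGluing (both Props inlined). Proof (elementary, planner NOTES
§glue): S := #{x ∈ Λ_n armed}, T := #{(x,y) ∈ Λ_n² : both armed, x ↔ y inside Λ_{Kn}} = Σ_classes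
W_c², N := #classes of armed sites under "joined inside Λ_{Kn}"; Cauchy–Schwarz S² ≤ N·T, so T ≥
S²/N0 on Few; E[T·1_Few] ≥ E[S²1_Few]/N0 ≥ (E[S 1_Few])²/N0 ≥ c²(E S)²/N0 = c²|Λ_n|²π_n²/N0 (E[S
1_Few] = Σ_x P(A_x ∩ Few); P(A_x) = π_n by DCT16.preimage_shift_siteToBoundary + shift-invariance of
bondPercolation); E T ≤ Σ_{x,y∈Λ_n} P(x ↔ y inside Λ_{Kn}) ≤ |Λ_n| Σ_{z∈Λ_{2n}} P(0 ↔ z inside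
Λ_{(K+1)n}) (shift by −x, Λ_{Kn}−x ⊆ Λ_{(K+1)n}); hence π_{2n}² ≤ π_n² ≤
(8N0/c²)|Λ_{2n}|⁻¹Σ_{z∈Λ_{2n}} τ^{Λ_{2Kn}}(0,z) (real_siteToBoundary_antitone, box_mono, |Λ_{2n}| ≤
8|Λ_n|); odd n by the same monotonicity with one more factor 8; n small absorbed in C. [difficulty:
M] -/
@[route_item "route-CriticalPhenomena-PercHyperscalingGluing"]
def FewClustersGlue : Prop :=
  (∃ N0 K : ℕ, ∃ c : ℝ, 0 < c ∧ 2 ≤ K ∧ ∀ n : ℕ, 1 ≤ n → c * ∑ x ∈ Literature.Probability.LatticeModels.box 3 n, (Literature.Probability.Percolation.bondPercolation (Literature.Probability.LatticeModels.zdGraph 3) (Literature.Probability.Percolation.criticalProbI 3)).real (Literature.Probability.Percolation.DCT16.armEvent x n) ≤ ∑ x ∈ Literature.Probability.LatticeModels.box 3 n, (Literature.Probability.Percolation.bondPercolation (Literature.Probability.LatticeModels.zdGraph 3) (Literature.Probability.Percolation.criticalProbI 3)).real (Literature.Probability.Percolation.DCT16.armEvent x n ∩ {ω | ∀ F : Finset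 (Literature.Probability.LatticeModels.Site 3), F ⊆ Literature.Probability.LatticeModels.box 3 n → (∀ y ∈ F, ω ∈ Literature.Probability.Percolation.DCT16.armEvent y n) → (↑F : Set (Literature.Probability.LatticeModels.Site 3)).Pairwise (fun y z => ω ∉ Literature.Probability.Percolation.openConnIn ↑(Literature.Probability.LatticeModels.box 3 (K * n)) y z) → F.card ≤ N0})) → (∃ C : ℝ, ∃ K : ℕ, 0 < C ∧ 1 ≤ K ∧ ∀ n : ℕ, 1 ≤ n → (Literature.Probability.Percolation.bondPercolation (Literature.Probability.LatticeModels.zdGraph 3) (Literature.Probability.Percolation.criticalProbI 3)).real (Literature.Probability.Percolation.siteToBoundary 3 n) ^ 2 ≤ C * ((Literature.Probability.LatticeModels.box 3 n).card : ℝ)⁻¹ * ∑ x ∈ Literature.Probability.LatticeModels.box 3 n, (Literature.Probability.Percolation.bondPercolation (Literature.Probability.LatticeModels.zdGraph 3) (Literature.Probability.Percolation.criticalProbI 3)).real (Literature.Probability.Percolation.openConnIn ↑(Literature.Probability.LatticeModels.box 3 (K * n)) 0 x))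

/-- item stmt-CriticalPhenomena-4647 · support · rank 9 · closed · proved by Summit.CriticalPhenomena.PercolationContinuityZ3.Theorems.cerfShortcut_proof @ 4b28c05a5d6f (prover) · by planner
sources: Cerf2015 Thm 1.3 and p.4 (arXiv:1306.3105), Hutchcroft2022 p.5, Literature.Probability.Percolation.theta_eq_zero_of_lt_criticalProb_holds
[support] Cerf's X_D (= crux LinearScaleLROOfTheta of route PercFiniteBoxLRO,
stmt-CriticalPhenomena-0855, Prop copied verbatim) → FreeBoxShattering → PercolationContinuityZ3: if
θ(p_c) > 0, X_D at p = criticalProbI 3 gives ρ > 0, K with ρ ≤ P_{p_c}(0 ↔ y inside Λ_{Kn}) for all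
y ∈ Λ_n, n ≥ 1; if K = 0 this is absurd at y ≠ 0 (openConnIn {0} 0 y = ∅); if K ≥ 1 then
|Λ_{Kn}|·F_{Kn} ≥ Σ_{y∈Λ_n} P(0 ↔ y inside Λ_{Kn}) ≥ ρ|Λ_n| ≥ ρ|Λ_{Kn}|/K³·(1/8), so F_{Kn} ≥
ρ/(8K³) for all n, contradicting F → 0 along r = Kn. Records that the renormalisation crux R
(RenormaliseFromLinearLRO, stmt-CriticalPhenomena-0857) of PercFiniteBoxLRO is superfluous once the
free box shatters; its tenure planner may attach this item there. [difficulty: provable-now] -/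
@[route_item "route-CriticalPhenomena-PercHyperscalingGluing"]
def CerfShortcut : Prop :=
  (∀ p : unitInterval, 0 < Literature.Probability.Percolation.theta (Literature.Probability.LatticeModels.zdGraph 3) 0 p → ∃ ρ : ℝ, 0 < ρ ∧ ∃ K : ℕ, ∀ n : ℕ, 1 ≤ n → ∀ x ∈ Literature.Probability.LatticeModels.box 3 n, ∀ y ∈ Literature.Probability.LatticeModels.box 3 n, ρ ≤ (Literature.Probability.Percolation.bondPercolation (Literature.Probability.LatticeModels.zdGraph 3) p).real (Literature.Probability.Percolation.openConnIn ↑(Literature.Probability.LatticeModels.box 3 (K * n)) x y)) → Filter.Tendsto (fun r : ℕ => ((Literature.Probability.LatticeModels.box 3 r).card : ℝ)⁻¹ * ∑ x ∈ Literature.Probability.LatticeModels.box 3 r, (Literature.Probability.Percolation.bondPercolation (Literature.Probability.LatticeModels.zdGraph 3) (Literature.Probability.Percolation.criticalProbI 3)).real (Literature.Probability.Percolation.openConnIn ↑(Literature.Probability.LatticeModels.box 3 r) 0 x)) Filter.atTop (nhds 0) → PercolationContinuityZ3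

/-- item stmt-CriticalPhenomena-4648 · assembly · rank 1 · closed · proved by Summit.CriticalPhenomena.PercolationContinuityZ3.Theorems.percHyperscalingGluing_assembly_proof @ 1a81be5e7dce (prover) · by planner
sources: GrimmettPercolation1999 §1.4 (theta <= P(0 <-> dB(n))), Hutchcroft2022 p.5, Literature.Probability.Percolation.DCT16.theta_le_real_siteToBoundary
[assembly] BoxGluing → FreeBoxShattering → PercolationContinuityZ3 (θ² ≤ π_n² ≤ C K³ F_{Kn} → 0;
proved in Sketch.lean, to be ported verbatim by a prover). -/
@[route_item "route-CriticalPhenomena-PercHyperscalingGluing"]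
def Assembly : Prop :=
  BoxGluing → FreeBoxShattering → PercolationContinuityZ3

/-! D-0027 §2.1 — DECIDING THEOREM (planner-authored via `route open/edit --closes-file`; by planner-rbadge-CriticalPhenomena-PercHyperscal-499ae70e-g4-0 2026-08-15T16:13:05Z):
its hypotheses are this route's items and its conclusion the sub-problem Statement (glue_lint), and it elaborates with this file. -/

/-- DECIDING THEOREM (D-0027 §2.1) of route PercHyperscalingGluing: the two cruxes BoxGluing and
FreeBoxShattering, together with the known fact ThetaLeOneArm (θ(p) ≤ P_p(0 ↔ ∂Λ_n), Grimmett1999 §1.4,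
in tree as `Literature.Probability.Percolation.DCT16.theta_le_real_siteToBoundary`), give θ(p_c) = 0 on ℤ³:
for n ≥ 1, θ² ≤ π_n² (ThetaLeOneArm) ≤ C·|Λ_n|⁻¹·Σ_{x∈Λ_n} τ^{Λ_{Kn}}(0,x) (BoxGluing)
≤ C·|Λ_n|⁻¹·Σ_{x∈Λ_{Kn}} τ^{Λ_{Kn}}(0,x) (box_mono, terms ≥ 0) = C·(|Λ_{Kn}|/|Λ_n|)·F_{Kn} ≤ C·K³·F_{Kn}
(card_box: (2Kn+1)³ ≤ K³(2n+1)³ for K ≥ 1), and F_{Kn} → 0 (FreeBoxShattering along n ↦ Kn → ∞), so θ² ≤ 0,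
θ = 0, which is `PercolationContinuityZ3` by unfolding. Sorry-free; axioms propext / Classical.choice / Quot.sound. -/
@[closes "route-CriticalPhenomena-PercHyperscalingGluing"] theorem closes : BoxGluing → FreeBoxShattering → ThetaLeOneArm → _root_.PercolationContinuityZ3 := by
  intro hB hF hT
  obtain ⟨C, K, hC, hK, hBn⟩ := hB
  show Literature.Probability.Percolation.theta (Literature.Probability.LatticeModels.zdGraph 3) 0
      (Literature.Probability.Percolation.criticalProbI 3) = 0
  -- notation
  set P : MeasureTheory.Measure (Literature.Probability.Percolation.BondConfig (Literature.Probability.LatticeModels.Site 3)) :=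
    Literature.Probability.Percolation.bondPercolation (Literature.Probability.LatticeModels.zdGraph 3)
      (Literature.Probability.Percolation.criticalProbI 3) with hP
  set θ : ℝ := Literature.Probability.Percolation.theta (Literature.Probability.LatticeModels.zdGraph 3) 0
      (Literature.Probability.Percolation.criticalProbI 3) with hθ
  set F : ℕ → ℝ := fun r : ℕ => ((Literature.Probability.LatticeModels.box 3 r).card : ℝ)⁻¹ *
      ∑ x ∈ Literature.Probability.LatticeModels.box 3 r,
        P.real (Literature.Probability.Percolation.openConnIn ↑(Literature.Probability.LatticeModels.box 3 r) 0 x) with hFdef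
  have hF' : Tendsto F atTop (𝓝 0) := hF
  have hθ0 : 0 ≤ θ := measureReal_nonneg
  have hK0 : 0 < K := hK
  -- cardinalities of boxes
  have hcard : ∀ L : ℕ, ((Literature.Probability.LatticeModels.box 3 L).card : ℝ) = (2 * (L : ℝ) + 1) ^ 3 := by
    intro L
    rw [Literature.Probability.LatticeModels.card_box]; push_cast; ring
  have hcard_pos : ∀ L : ℕ, (0 : ℝ) < ((Literature.Probability.LatticeModels.box 3 L).card : ℝ) := by
    intro L; rw [hcard]; positivity
  -- the key finite-n inequality θ² ≤ C K³ F(Kn)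
  have key : ∀ n : ℕ, 1 ≤ n → θ ^ 2 ≤ C * (K : ℝ) ^ 3 * F (K * n) := by
    intro n hn
    have h1 : θ ^ 2 ≤ P.real (Literature.Probability.Percolation.siteToBoundary 3 n) ^ 2 :=
      pow_le_pow_left₀ hθ0 (hT 3 _ n) 2
    have h2 := hBn n hn
    -- enlarge the averaging box Λ_n ⊆ Λ_{Kn}
    have hsub : Literature.Probability.LatticeModels.box 3 n ⊆ Literature.Probability.LatticeModels.box 3 (K * n) :=
      Literature.Probability.LatticeModels.box_mono 3 (le_mul_of_one_le_left (Nat.zero_le n) hK)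
    have h3 : ∑ x ∈ Literature.Probability.LatticeModels.box 3 n,
          P.real (Literature.Probability.Percolation.openConnIn ↑(Literature.Probability.LatticeModels.box 3 (K * n)) 0 x)
        ≤ ∑ x ∈ Literature.Probability.LatticeModels.box 3 (K * n),
          P.real (Literature.Probability.Percolation.openConnIn ↑(Literature.Probability.LatticeModels.box 3 (K * n)) 0 x) :=
      Finset.sum_le_sum_of_subset_of_nonneg hsub fun _ _ _ => measureReal_nonneg
    have h4 : ∑ x ∈ Literature.Probability.LatticeModels.box 3 (K * n),
          P.real (Literature.Probability.Percolation.openConnIn ↑(Literature.Probability.LatticeModels.box 3 (K * n)) 0 x)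
        = ((Literature.Probability.LatticeModels.box 3 (K * n)).card : ℝ) * F (K * n) := by
      simp only [hFdef]
      rw [← mul_assoc, mul_inv_cancel₀ (hcard_pos (K * n)).ne', one_mul]
    have hFn : 0 ≤ F (K * n) := by
      simp only [hFdef]
      exact mul_nonneg (inv_nonneg.2 (hcard_pos _).le) (Finset.sum_nonneg fun _ _ => measureReal_nonneg)
    -- ratio of volumes ≤ K³
    have hratio : ((Literature.Probability.LatticeModels.box 3 (K * n)).card : ℝ)
        ≤ (K : ℝ) ^ 3 * ((Literature.Probability.LatticeModels.box 3 n).card : ℝ) := by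
      rw [hcard, hcard, ← mul_pow]
      push_cast
      have hK1 : (1 : ℝ) ≤ K := by exact_mod_cast hK
      have hn0 : (0 : ℝ) ≤ n := Nat.cast_nonneg n
      apply pow_le_pow_left₀ (by positivity)
      nlinarith
    have ha := hcard_pos n
    calc θ ^ 2 ≤ P.real (Literature.Probability.Percolation.siteToBoundary 3 n) ^ 2 := h1
      _ ≤ C * ((Literature.Probability.LatticeModels.box 3 n).card : ℝ)⁻¹ *
            ∑ x ∈ Literature.Probability.LatticeModels.box 3 n,
              P.real (Literature.Probability.Percolation.openConnIn ↑(Literature.Probability.LatticeModels.box 3 (K * n)) 0 x) := h2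
      _ ≤ C * ((Literature.Probability.LatticeModels.box 3 n).card : ℝ)⁻¹ *
            (((Literature.Probability.LatticeModels.box 3 (K * n)).card : ℝ) * F (K * n)) := by
          rw [← h4]
          exact mul_le_mul_of_nonneg_left h3 (mul_nonneg hC.le (inv_nonneg.2 ha.le))
      _ ≤ C * ((Literature.Probability.LatticeModels.box 3 n).card : ℝ)⁻¹ *
            (((K : ℝ) ^ 3 * ((Literature.Probability.LatticeModels.box 3 n).card : ℝ)) * F (K * n)) := by
          exact mul_le_mul_of_nonneg_left (mul_le_mul_of_nonneg_right hratio hFn)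
            (mul_nonneg hC.le (inv_nonneg.2 ha.le))
      _ = C * (K : ℝ) ^ 3 * F (K * n) *
            ((((Literature.Probability.LatticeModels.box 3 n).card : ℝ))⁻¹ *
              ((Literature.Probability.LatticeModels.box 3 n).card : ℝ)) := by ring
      _ = C * (K : ℝ) ^ 3 * F (K * n) := by rw [inv_mul_cancel₀ ha.ne', mul_one]
  -- F(Kn) → 0
  have hKn : Tendsto (fun n : ℕ => K * n) atTop atTop :=
    tendsto_atTop_mono (fun n => le_mul_of_one_le_left (Nat.zero_le n) hK) tendsto_id
  have hlim : Tendsto (fun n : ℕ => C * (K : ℝ) ^ 3 * F (K * n)) atTop (𝓝 0) := by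
    have := (hF'.comp hKn).const_mul (C * (K : ℝ) ^ 3)
    simpa using this
  have hsq : θ ^ 2 ≤ 0 := ge_of_tendsto hlim (eventually_atTop.2 ⟨1, key⟩)
  exact pow_eq_zero_iff two_ne_zero |>.1 (le_antisymm hsq (sq_nonneg θ))

end Summit.CriticalPhenomena.PercolationContinuityZ3.Theses.PercHyperscalingGluing
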